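import Summits.Langlands.Langlands.Theorems.PicardMuOrdinaryMuOrdinaryFamilyRTThorneCompanionsDebts
import HarnessLib

/-!
# Crux `MuOrdinaryFamilyRT` (stmt-Langlands-13757), line `thorne-minimal-lift`: glue G4b of
# `stub_pointAutomorphicT` — the Borel-of-weight clause for the bare point representation over `F'`
# gives `IsOrdinaryOfLabelledWeightAt` for the framed restriction (`…_restrictField_of_isBorelOfWeightAt`)

Let `K = ℚ(ζ₃)`, `F'/K` a number field, `w` a finite place of `F'`, `L = F'_w`, `art` a local Artin
datum of `L`, `ρy : Γ_K → GL₃(ℚ̄₃)` a framed representation and `λ` a labelled weight.  The clause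
`IsBorelOfWeightAt F' w art (ρy ∘ res_{K}^{F'}) λ` (…ThorneCompanionsDebts § 1, clause (e) of
`HasOrdinaryCompanion`) says: for some `g ∈ GL₃(ℚ̄₃)` and some open `U ≤ Γ_L`, every
`g⁻¹ ρy(τ) g` (`τ ∈ Γ_L`) is `IsUpper3` (entries `(1,0)`, `(2,0)`, `(2,1)` vanish) and on the inertia
elements `τw` with image in `U` the diagonal entries are `ordinaryWeightUnit λ i (Art⁻¹ τw)`.  The
Literature predicate `FramedGaloisRep.IsOrdinaryOfLabelledWeightAt w art (ρy.restrictField F') λ`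
(OrdinaryRegular.lean) asks for a frame `P` with `P ρ P⁻¹` upper triangular (`(i,j)` entry zero for
`j < i`) and the same diagonal condition.  Taking `P = g⁻¹` (`FramedRep.conj P ρ τ = P ρ(τ) P⁻¹ =
g⁻¹ ρ(τ) g`) the two statements agree entry by entry; the only work is matching the two
upper-triangularity conventions on `Fin 3` (`fin_cases`).

This is the registered stub `isOrdinaryOfLabelledWeightAt_restrictField_of_isBorelOfWeightAt`
(glue G4b of the blueprint `thorne-minimal-lift-pointAutomorphic.md`).
-/

set_option linter.dupNamespace false -- `Summit.Langlands.Langlands.…` is the problem's namespace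

namespace Summit.Langlands.Langlands.Cruxes.MuOrdinaryFamilyRT.ThorneMinimalLift

open scoped NumberField Polynomial Matrix Classical
open Field IsDedekindDomain Polynomial
open Literature.NumberTheory.GaloisRepresentations Literature.NumberTheory.Automorphic
open Summit.Langlands.Langlands.Cruxes.MuOrdinaryFamilyRT.CharZeroDominance

noncomputable section

/-- The two upper-triangularity conventions on `3 × 3` matrices agree: `IsUpper3 M` (entries
`(1,0)`, `(2,0)`, `(2,1)` vanish) iff `M i j = 0` for all `j < i`. -/
theorem isUpper3_iff_forall_lt {R : Type*} [CommRing R] (M : Matrix (Fin 3) (Fin 3) R) :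
    IsUpper3 M ↔ ∀ i j : Fin 3, j < i → M i j = 0 := by
  constructor
  · rintro ⟨h10, h20, h21⟩ i j hij
    fin_cases i <;> fin_cases j <;> simp_all [Fin.lt_def]
  · intro h
    exact ⟨h 1 0 (by decide), h 2 0 (by decide), h 2 1 (by decide)⟩

/-- **Glue G4b of `stub_pointAutomorphicT`.**  If the bare homomorphism `ρy ∘ res_K^{F'} : Γ_{F'} →
GL₃(ℚ̄₃)` is Borel of weight `λ` at `w` in the frame `g` (`IsBorelOfWeightAt`: `g⁻¹ ρy g` upper
triangular on `Γ_{F'_w}` with diagonal `ordinaryWeightUnit λ i ∘ Art⁻¹` on an open subgroup of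
inertia), then the framed restriction `ρy|_{Γ_{F'}}` is ordinary of labelled weight `λ` at `w`
(`FramedGaloisRep.IsOrdinaryOfLabelledWeightAt`), in the frame `P = g⁻¹` of `FramedRep.conj`
(`P ρ P⁻¹ = g⁻¹ ρ g`). -/
theorem isOrdinaryOfLabelledWeightAt_restrictField_of_isBorelOfWeightAt : ∀ (F' : Type) [Field F'] [NumberField F'] [Algebra K F'] (w : HeightOneSpectrum (𝓞 F')) (art : LocalArtinData (w.adicCompletion F')) (ρy : FramedGaloisRep K (PadicAlgCl 3) 3) (wt : LabelledWeight (w.adicCompletion F') (PadicAlgCl 3) 3), IsBorelOfWeightAt F' w art ((ρy : absoluteGaloisGroup K →* GL (Fin 3) (PadicAlgCl 3)).comp (absGaloisRestrict K F').toMonoidHom) wt → FramedGaloisRep.IsOrdinaryOfLabelledWeightAt w art (ρy.restrictField F') wt := by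
  intro F' _ _ _ w art ρy wt hB
  obtain ⟨g, U, hup, hdiag⟩ := hB
  rw [FramedGaloisRep.isOrdinaryOfLabelledWeightAt_iff, FramedGaloisRep.isOrdinaryOfLabelledWeight_iff]
  refine ⟨g⁻¹, ?_, U, ?_⟩
  · -- upper triangularity in the frame `g⁻¹`
    intro σ i j hij
    have h := (isUpper3_iff_forall_lt _).1 (hup σ) i j hij
    simpa [FramedRep.conj_apply, inv_inv] using h
  · -- the diagonal characters on the open subgroup `U` of inertia
    intro τw hτw hU i
    have h := hdiag τw hτw hU i
    simpa [FramedRep.conj_apply, inv_inv] using h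

end

end Summit.Langlands.Langlands.Cruxes.MuOrdinaryFamilyRT.ThorneMinimalLift
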